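import Literature.NumberTheory.EllipticCurves.RationalPointRankTwoCriteria
import Literature.NumberTheory.EllipticCurves.RationalIsogenyFrobeniusCriterion
import Summits.BirchSwinnertonDyer.Rank1Residual.Supersingular.RankOneRem13RecordShapesCount
import HarnessLib

/-!
# Kernel MULTIPLES OF RATIONAL POINTS by a division-free double-and-add LADDER over `ℚ` (TOOL), and the
# RED-pair rank-TWO certificate `2 ≤ rank_ℤ E(ℚ)` made fully kernel-checkable

Cell `b2b-bsdres`, supersingular family, prover A = unit `b2b-bsdres-x10b` (gen 16).  Topic file; namespace
`Summit.BirchSwinnertonDyer.Rank1Residual.Supersingular`.  TOOL: the chord/tangent law of a Weierstrass curve over `ℚ` replayed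
with SUPPLIED slopes and checked division-free by `decide` (the `ℚ`-twin of `CyclicityLadder.lean`, x10b gen 13, which does the
same over `𝔽_ℓ`); small computable definitions and their soundness; no named fact, no `Prop` minted, nothing booked.

HONEST FRAMING (run/shared/lean/b2b/bsd-rank1-residual/, verbatim in every file): the goal of the
cell is to DELETE the COMBINATION-SHAPED residual classes of the Birch–Swinnerton-Dyer formula for
ALL analytic-rank `≤ 1` elliptic curves over `ℚ` — "full BSD formula for every rank `≤ 1` curve in
class `C`" assembled STRICTLY from published theorems — so that the rank-`≤ 1` remainder becomes
exactly the CONSTRUCTION-SHAPED classes, which are TYPED (missing-input `Prop`s), NOT attempted.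
This is not "finishing BSD".  Classes X6 / X7 stay CONSTRUCTION-SHAPED; nothing here moves a label.

## What this file is for

The visibility records of the cell (`X6Visibility*`, `X7Visibility*`) display the partner's rank as a binder
`hrank : 2 ≤ F.mordellWeilRank` whenever the refined count needs two units of rank (a PAID place).  The tree's
`Literature.two_le_mordellWeilRank_of_redPair` (RationalPointRankTwoCriteria, cc-typer-2) turns a RED-pair certificate into
`2 ≤ rank`, but its hypotheses are POINT EQUALITIES `(N_ℓ/m) • (P + c • Q) = (x, y)` that no file of the tree could so far
discharge by computation.  Here: §1 the ladder over `ℚ` (`QStep`, `dblOKQ`, `addOKQ`, `ladderRunQ`, `qScalar`) with soundness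
`nsmul_some_eq_of_ladderRunQ` (`(qScalar 1 steps) • (x₀,y₀) = (x_f,y_f)` on any `W/ℚ`, checks stated with `W.a₁ … W.a₄`) and the chord form
`some_add_some_eq_of_addOKQ`; §2 the glue `reductionPointCount_mk_eq_of_countPoints` (`N_ℓ` of the literal globally minimal model
from the schema count).  A record then discharges every hypothesis of `two_le_mordellWeilRank_of_redPair` by `decide +kernel` on
rational numerals (the multiples have a few hundred to a few thousand digits; GMP-backed kernel arithmetic).

References: J. H. Silverman, *The Arithmetic of Elliptic Curves*, 2nd ed., GTM 106 (2009), III.2.3 (group law), VII.3.1,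
VIII.6.7 [SilvermanAEC2009]; J. W. S. Cassels, *Lectures on Elliptic Curves* (1991) §13 [folklore].
-/

set_option autoImplicit false

open WeierstrassCurve Literature.NumberTheory.EllipticCurves Literature.NumberTheory.EllipticCurves.Rank1Residual.X11RankOneCertificates

namespace Summit.BirchSwinnertonDyer.Rank1Residual.Supersingular

/-! ### §1 The division-free double-and-add ladder over `ℚ` -/

section Ladder

/-- One step of the left-to-right binary ladder for `m • P₀` over `ℚ`: DOUBLE the accumulator (tangent slope `ld`, result
`(xd, yd)`), then, if `bit`, ADD the base point (chord slope `la`, result `(xa, ya)`); for `bit = false` the fields `la, xa, ya`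
are ignored. [cite: SilvermanAEC2009, III.2.3] -/
structure QStep where
  /-- the binary digit of the scalar consumed by this step -/ bit : Bool
  /-- tangent slope of the doubling -/ ld : ℚ
  /-- `x` after doubling -/ xd : ℚ
  /-- `y` after doubling -/ yd : ℚ
  /-- chord slope of the addition of the base point (if `bit`) -/ la : ℚ
  /-- `x` after the addition (if `bit`) -/ xa : ℚ
  /-- `y` after the addition (if `bit`) -/ ya : ℚ

/-- Division-free TANGENT check on `⟨a₁,…,a₆⟩/ℚ`: `D = 2y₁ + a₁x₁ + a₃ ≠ 0`, `L·D = 3x₁² + 2a₂x₁ + a₄ − a₁y₁`, and `(x₃, y₃)` are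
Mathlib's `addX x₁ x₁ L`, `addY x₁ x₁ y₁ L`. [cite: SilvermanAEC2009, III.2.3] -/
def dblOKQ (a1 a2 a3 a4 : ℚ) (x₁ y₁ L x₃ y₃ : ℚ) : Bool :=
  decide (2 * y₁ + a1 * x₁ + a3 ≠ 0) &&
  decide (L * (2 * y₁ + a1 * x₁ + a3) = 3 * x₁ ^ 2 + 2 * a2 * x₁ + a4 - a1 * y₁) &&
  decide (x₃ = L ^ 2 + a1 * L - a2 - x₁ - x₁) &&
  decide (y₃ = -(L * (x₃ - x₁) + y₁) - a1 * x₃ - a3)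

/-- Division-free CHORD check on `⟨a₁,…,a₆⟩/ℚ`: `x₁ ≠ x₂`, `L·(x₁ − x₂) = y₁ − y₂`, and `(x₃, y₃)` are Mathlib's `addX x₁ x₂ L`,
`addY x₁ x₂ y₁ L`. [cite: SilvermanAEC2009, III.2.3] -/
def addOKQ (a1 a2 a3 : ℚ) (x₁ y₁ x₂ y₂ L x₃ y₃ : ℚ) : Bool :=
  decide (x₁ ≠ x₂) &&
  decide (L * (x₁ - x₂) = y₁ - y₂) &&
  decide (x₃ = L ^ 2 + a1 * L - a2 - x₁ - x₂) &&
  decide (y₃ = -(L * (x₃ - x₁) + y₁) - a1 * x₃ - a3)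

/-- Replay of the ladder from the accumulator `(x, y)` with base point `(x₀, y₀)`: `some (x_f, y_f)` if every step passes its
check, `none` otherwise. [cite: SilvermanAEC2009, III.2.3] -/
def ladderRunQ (a1 a2 a3 a4 : ℚ) (x₀ y₀ : ℚ) : ℚ → ℚ → List QStep → Option (ℚ × ℚ)
  | x, y, [] => some (x, y)
  | x, y, s :: rest =>
    if dblOKQ a1 a2 a3 a4 x y s.ld s.xd s.yd then
      if s.bit then
        (if addOKQ a1 a2 a3 s.xd s.yd x₀ y₀ s.la s.xa s.ya then ladderRunQ a1 a2 a3 a4 x₀ y₀ s.xa s.ya rest else none)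
      else ladderRunQ a1 a2 a3 a4 x₀ y₀ s.xd s.yd rest
    else none

/-- The scalar computed by the ladder: `k ↦ 2k + bit` per step. [folklore] -/
def qScalar : ℕ → List QStep → ℕ
  | k, [] => k
  | k, s :: rest => qScalar (2 * k + (if s.bit then 1 else 0)) rest

variable {W : WeierstrassCurve ℚ}

/-- Two affine points with equal coordinates are equal (proof irrelevance in `Point.some`). [folklore] -/
theorem exists_some_eq_of_eq_rat {x y x' y' : ℚ} (h : W.toAffine.Nonsingular x y) (hx : x = x') (hy : y = y') :
    ∃ h' : W.toAffine.Nonsingular x' y', (Affine.Point.some x y h : W.toAffine.Point) = Affine.Point.some x' y' h' := by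
  subst hx hy; exact ⟨h, rfl⟩

/-- **Soundness of the tangent check**: `dblOKQ x₁ y₁ L x₃ y₃ ⟹ (x₁,y₁) + (x₁,y₁) = (x₃,y₃)` on `⟨a₁,…,a₆⟩/ℚ`.
[cite: SilvermanAEC2009, III.2.3] -/
theorem add_self_eq_of_dblOKQ {x₁ y₁ L x₃ y₃ : ℚ} (h₁ : W.toAffine.Nonsingular x₁ y₁)
    (hok : dblOKQ W.a₁ W.a₂ W.a₃ W.a₄ x₁ y₁ L x₃ y₃ = true) :
    ∃ h₃ : W.toAffine.Nonsingular x₃ y₃,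
      (Affine.Point.some x₁ y₁ h₁ : W.toAffine.Point) + Affine.Point.some x₁ y₁ h₁ = Affine.Point.some x₃ y₃ h₃ := by
  simp only [dblOKQ, Bool.and_eq_true, decide_eq_true_eq] at hok
  obtain ⟨⟨⟨hD, hL⟩, hx₃⟩, hy₃⟩ := hok
  have hDval : y₁ - W.toAffine.negY x₁ y₁ = 2 * y₁ + W.a₁ * x₁ + W.a₃ := by
    simp only [Affine.negY]; ring
  have hy : y₁ ≠ W.toAffine.negY x₁ y₁ := by
    intro h; apply hD; rw [← hDval, sub_eq_zero.mpr h]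
  have hslope : W.toAffine.slope x₁ x₁ y₁ y₁ = L := by
    rw [Affine.slope_of_Y_ne rfl hy, hDval, div_eq_iff hD, hL]
  rw [Affine.Point.add_self_of_Y_ne hy]
  refine exists_some_eq_of_eq_rat _ ?_ ?_
  · rw [hslope, hx₃]; simp only [Affine.addX]
  · rw [hslope, hy₃, hx₃]
    simp only [Affine.addY, Affine.negAddY, Affine.addX, Affine.negY]

/-- **Soundness of the chord check**: `addOKQ x₁ y₁ x₂ y₂ L x₃ y₃ ⟹ (x₁,y₁) + (x₂,y₂) = (x₃,y₃)` on `⟨a₁,…,a₆⟩/ℚ`.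
[cite: SilvermanAEC2009, III.2.3] -/
theorem some_add_some_eq_of_addOKQ {x₁ y₁ x₂ y₂ L x₃ y₃ : ℚ} (h₁ : W.toAffine.Nonsingular x₁ y₁)
    (h₂ : W.toAffine.Nonsingular x₂ y₂) (hok : addOKQ W.a₁ W.a₂ W.a₃ x₁ y₁ x₂ y₂ L x₃ y₃ = true) :
    ∃ h₃ : W.toAffine.Nonsingular x₃ y₃,
      (Affine.Point.some x₁ y₁ h₁ : W.toAffine.Point) + Affine.Point.some x₂ y₂ h₂ = Affine.Point.some x₃ y₃ h₃ := by
  simp only [addOKQ, Bool.and_eq_true, decide_eq_true_eq] at hok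
  obtain ⟨⟨⟨hx, hL⟩, hx₃⟩, hy₃⟩ := hok
  have hslope : W.toAffine.slope x₁ x₂ y₁ y₂ = L := by
    rw [Affine.slope_of_X_ne hx, div_eq_iff (sub_ne_zero.mpr hx), hL]
  rw [Affine.Point.add_of_X_ne hx]
  refine exists_some_eq_of_eq_rat _ ?_ ?_
  · rw [hslope, hx₃]; simp only [Affine.addX]
  · rw [hslope, hy₃, hx₃]
    simp only [Affine.addY, Affine.negAddY, Affine.addX, Affine.negY]

/-- **Soundness of the ladder**: if `k • P₀ = (x, y)` and the run from `(x, y)` succeeds, then `(qScalar k steps) • P₀` is the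
affine point the run ends in. [cite: SilvermanAEC2009, III.2.3] -/
theorem ladderRunQ_sound {x₀ y₀ : ℚ} (h₀ : W.toAffine.Nonsingular x₀ y₀) :
    ∀ (steps : List QStep) (k : ℕ) (x y : ℚ) (h : W.toAffine.Nonsingular x y),
      k • (Affine.Point.some x₀ y₀ h₀ : W.toAffine.Point) = Affine.Point.some x y h →
      ∀ xf yf : ℚ, ladderRunQ W.a₁ W.a₂ W.a₃ W.a₄ x₀ y₀ x y steps = some (xf, yf) →
      ∃ hf : W.toAffine.Nonsingular xf yf,
        (qScalar k steps) • (Affine.Point.some x₀ y₀ h₀ : W.toAffine.Point) = Affine.Point.some xf yf hf := by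
  intro steps
  induction steps with
  | nil =>
    intro k x y h hk xf yf hrun
    simp only [ladderRunQ, Option.some.injEq, Prod.mk.injEq] at hrun
    obtain ⟨rfl, rfl⟩ := hrun
    exact ⟨h, hk⟩
  | cons s rest ih =>
    intro k x y h hk xf yf hrun
    rw [show qScalar k (s :: rest) = qScalar (2 * k + (if s.bit then 1 else 0)) rest from rfl]
    simp only [ladderRunQ] at hrun
    split_ifs at hrun with hd hb hadd
    · obtain ⟨hd', hdd⟩ := add_self_eq_of_dblOKQ h hd
      obtain ⟨ha', haa⟩ := some_add_some_eq_of_addOKQ hd' h₀ hadd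
      rw [if_pos hb]
      refine ih (2 * k + 1) _ _ ha' ?_ xf yf hrun
      rw [succ_nsmul, two_mul, add_nsmul, hk, hdd, haa]
    · obtain ⟨hd', hdd⟩ := add_self_eq_of_dblOKQ h hd
      rw [if_neg hb, add_zero]
      refine ih (2 * k) _ _ hd' ?_ xf yf hrun
      rw [two_mul, add_nsmul, hk, hdd]

/-- **Multiples by certificate**: if the ladder with base point `(x₀, y₀)` started at `(x₀, y₀)` runs to `(x_f, y_f)`, then
`(qScalar 1 steps) • (x₀, y₀) = (x_f, y_f)` — the point equality needed by the RED-pair checker, decided by `decide` on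
rational numerals. [cite: SilvermanAEC2009, III.2.3] -/
theorem nsmul_some_eq_of_ladderRunQ {x₀ y₀ xf yf : ℚ} (h₀ : W.toAffine.Nonsingular x₀ y₀) (steps : List QStep)
    (hrun : ladderRunQ W.a₁ W.a₂ W.a₃ W.a₄ x₀ y₀ x₀ y₀ steps = some (xf, yf)) :
    ∃ hf : W.toAffine.Nonsingular xf yf,
      (qScalar 1 steps) • (Affine.Point.some x₀ y₀ h₀ : W.toAffine.Point) = Affine.Point.some xf yf hf :=
  ladderRunQ_sound h₀ steps 1 x₀ y₀ h₀ (one_nsmul _) xf yf hrun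

end Ladder

/-! ### §2 Glue for the RED-pair checker: `N_ℓ` and `ℓ ∤ Δ_min` of a globally minimal `W` from its integer model -/

section Count

open Summit.BirchSwinnertonDyer.BirchSwinnertonDyer.Rank1Residual.IntModel
open Summit.BirchSwinnertonDyer.BirchSwinnertonDyer.Rank1Residual.X11RankOne (intCurve_Δ)

/-- **`N_ℓ` from the schema count**: for a globally minimal `W/ℚ` with integer model `E₀ = ⟨a₁,…,a₆⟩` (`integralModelInt W = E₀`),
an odd prime `ℓ ∤ Δ(E₀)` and `countPoints [a₁,…,a₆] ℓ = n`: `reductionPointCount W ℓ = n`. [cite: SilvermanAEC2009, VII.5 Prop. 5.1(a)] -/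
theorem reductionPointCount_eq_of_intModel_countPoints {W : WeierstrassCurve ℚ} [W.IsGloballyMinimal]
    {a1 a2 a3 a4 a6 : ℤ} (hI : integralModelInt W = ⟨a1, a2, a3, a4, a6⟩) (ℓ : ℕ) [Fact ℓ.Prime] (hℓ2 : ℓ ≠ 2)
    (hℓΔ : ¬ (ℓ : ℤ) ∣ discOf [a1, a2, a3, a4, a6]) {n : ℕ} (hc : countPoints [a1, a2, a3, a4, a6] ℓ = n) :
    W.reductionPointCount ℓ = n := by
  rw [reductionPointCount, hI]
  exact natCard_point_eq_of_countPoints a1 a2 a3 a4 a6 ℓ hℓ2 hℓΔ hc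

/-- `ℓ ∤ Δ_min(W)` from `ℓ ∤ Δ(E₀)` for the integer model `E₀ = ⟨a₁,…,a₆⟩` of a globally minimal `W`. [folklore] -/
theorem not_dvd_minimalDiscriminantInt_of_intModel {W : WeierstrassCurve ℚ} [W.IsGloballyMinimal]
    {a1 a2 a3 a4 a6 : ℤ} (hI : integralModelInt W = ⟨a1, a2, a3, a4, a6⟩) {ℓ : ℕ}
    (hℓΔ : ¬ (ℓ : ℤ) ∣ discOf [a1, a2, a3, a4, a6]) : ¬ (ℓ : ℤ) ∣ minimalDiscriminantInt W := by
  rw [minimalDiscriminantInt, hI, intCurve_Δ]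
  exact hℓΔ

end Count

/-! ### §3 Sample -/

/-- The empty ladder computes the scalar `1`. [folklore] -/
theorem qScalar_nil_sample : qScalar 1 [] = 1 := rfl

end Summit.BirchSwinnertonDyer.Rank1Residual.Supersingular
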